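import Summits.BirchSwinnertonDyer.BirchSwinnertonDyer.Theorems.SignedLowerHalvesSmallImageLowerHalfBothSignsLambdaLowerThreeNs
import Summits.BirchSwinnertonDyer.BirchSwinnertonDyer.Theorems.SignedLowerHalvesSmallImageLowerHalfBothSignsLambdaParityMuFree
import HarnessLib

/-!
# Route `SignedLowerHalves` (K3), child crux L `SmallImageLowerHalfBothSigns` (item stmt-BirchSwinnertonDyer-23599),
# line `birth_acns`, stub `stub_lambdaLowerThree_ns` (= retired item 23118 `SmallImageLambdaLowerAtThree`, VERBATIM):
# the PARITY REFINEMENT of the stub's excess-zero residue — ONE excess zero is impossible; the stub BY NAME ⟸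
# the two preprint loci ∧ Kobayashi Thm. 1.2 / 4.1 ∧ the `p`-parity theorem at `3` ∧ the PAIRED-EXCESS residue
# «`corank Sel_{3^∞}(E/ℚ) + 2 ≤ λ(L_3^ε)`» (cell `bsd-ssimc`, width seat `bsd-line-slh-p3-w3` gen 3; helper `--supports 23599`)

HONEST FRAMING: CALIBRATION / SUPPORT ONLY. The stub is OPEN MATHEMATICS (w3 g0: no engine in print at non-square-free
conductor and small image, `stub-blocked`); nothing here closes it; BSD / child L / the stub are NOT proved. Every
theorem is CONDITIONAL on DISPLAYED binders — published named facts (`h12`, `h41`, `h3`, the `p`-parity theorem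
`p_parity W 3`), the tree's two unrefereed binders (`FouquetWan2021_thm51_via_kobayashi74_OPEN`,
`BurungaleSkinnerTianWan2024_thm13_twist_OPEN`), or the residue of the stub itself. THEOREMS ONLY; no definition, no
named fact, no `sorry`.

## What is proved (on top of w3 g0's `…LambdaLowerThreeNs.lean` and this gen's μ-free λ-parity `…LambdaParityMuFree.lean`)

* §1 (per pair and sign; odd good `p`, `a_p = 0`, ANY image, ANY `μ`): `even_lam_kobayashiL_sub_selmerCorank` — granted
  `h12`, `h41` (rational display) and `p_parity W p`, the number of EXCESS ZEROS `λ(L_p^ε) − corank_{ℤ_p} Sel_{p^∞}(E/ℚ)`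
  is EVEN (it is `≥ 0` by g0's `selmerCorank_le_lam_kobayashiL`); **`lambdaShape_of_lam_le_selmerCorank_add_one`** —
  the corank squeeze WIDENED BY ONE: `λ(L_p^ε) ≤ corank + 1` already gives the stub's `p`-inverted λ-shape at every
  dual datum of that sign (ONE excess zero is impossible by parity, so `λ ≤ corank + 1 ⇒ λ ≤ corank`, then g0's squeeze).
* §2 **`smallImageLambdaLowerAtThree_of_loci_of_pairedExcessZeroResidue`** — the stub BY NAME ⟸ `hFW ∧ hBSTW ∧ h12 ∧ h41`
  ∧ `hpar : ∀ E/ℚ, p_parity E 3` (Dokchitser–Dokchitser 2010 Thm. 1.4, with Cor. 4.20 at `p = 3`) ∧ `hres2` = the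
  λ-inequality `λ(L_3^ε) ≤ λ(ξ^ε)` ONLY at the pairs off both loci whose `L_3^ε` has AT LEAST TWO excess zeros
  (`corank + 2 ≤ λ(L_3^ε)`); and the (trivial) converse `pairedExcessZeroResidue_of_smallImageLambdaLowerAtThree`
  (granted `h3` to instantiate the stub). READING (numbers, not adjectives): w3 g0 left the residue at «`corank < λ`»;
  the μ-free parity theorem makes the first excess zero free, so the open content of `stub_lambdaLowerThree_ns` is
  «at the small-image `p = 3` X7 pairs off the FW / BSTW-twist loci with `λ(L_3^ε) ≥ corank + 2`, the excess zeros
  of `L_3^ε` divide `ξ^ε`» — a statement about pairs with a GENUINE extra pair of zeros `a ↔ (1+a)⁻¹ − 1` in the open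
  disc, the locus where only an Euler-system / congruence ENGINE (not parity, not the corank) can act.

References: [Kobayashi2003] Thm. 1.2, Thm. 4.1 (p. 8), Conjecture (p. 2); [DokchitserDokchitserAnnals2010] Thm. 1.4, Cor. 4.20;
[Sprung2017] Cor. 4.14; [GreenbergLNM1716] §3 Lemma 3.1, §5 p. 181; [GreenbergVatsal2000] p. 4; [Mazur1978] Cor. 4.1;
[FouquetWan2021] Thm. 5.1 (PRE); [BurungaleSkinnerTianWan2024] Thm. 1.3 (PRE).
-/

set_option autoImplicit false
-- D-0017: single-problem summit, the namespace repeats the problem name by design.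
set_option linter.dupNamespace false

noncomputable section

open scoped Classical MatrixGroups ModularForm

open CongruenceSubgroup PowerSeries WeierstrassCurve Field Literature.NumberTheory.EllipticCurves
  Literature.NumberTheory.EllipticCurves.ModularForms
  Literature.NumberTheory.EllipticCurves.Rank1Residual
  Literature.NumberTheory.EllipticCurves.Kobayashi2003 ZpExtension
  Literature.NumberTheory.EllipticCurves.Rank1Residual.Typed
  Summit.BirchSwinnertonDyer.Rank1Residual.X1.MuLambda
  Summit.BirchSwinnertonDyer.Rank1Residual.Supersingular

namespace Summit.BirchSwinnertonDyer.BirchSwinnertonDyer.Theorems.SmallImageLambdaLowerThreeNsParity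

open SmallImageLambdaLowerThreeNsDoor SmallImageLambdaLowerThreeNs SmallImageLambdaParityMuFree

/-! ## §1. Per pair and sign: the excess is EVEN; the corank squeeze widened by one -/

section PerPair

variable {p : ℕ} [Fact p.Prime] {W : WeierstrassCurve ℚ} [W.IsElliptic] [W.IsGloballyMinimal]
  {κ : ZpExtension ℚ p} {γ : absoluteGaloisGroup ℚ} {ε : ℤˣ}

/-- **The number of excess zeros `λ(L_p^ε) − corank_{ℤ_p} Sel_{p^∞}(E/ℚ)` is EVEN** (and `≥ 0` by
`selmerCorank_le_lam_kobayashiL`), granted Kobayashi Thm. 1.2 (`h12`), Thm. 4.1's rational display (`h41`) and the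
`p`-parity theorem (`hpar`); odd good `p`, `a_p = 0`, newform of level `N_E`, a cyclotomic frame (only to instantiate a
dual datum), ANY image, ANY `μ`. [cite: Kobayashi2003, Thm. 1.2 and Thm. 4.1 (p. 8)] [cite: DokchitserDokchitserAnnals2010, Thm. 1.4]
[cite: Sprung2017, Cor. 4.14 (a_p = 0 display)] -/
theorem even_lam_kobayashiL_sub_selmerCorank (h12 : Kobayashi2003.thm12_signedSelmerDual_finite_torsion)
    (h41 : Kobayashi2003.thm41_signedCharIdeal_divisibility) (hpar : p_parity W p) (hp : p ≠ 2)
    (hgood : W.HasGoodReductionAtPrime p) (hap : W.frobeniusTrace p = 0) [NeZero (W.conductorNorm ℤ)]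
    {f : CuspForm (Gamma0 (W.conductorNorm ℤ)) 2} (hf : IsNewformOf W f) (hκ : κ.IsCyclotomic)
    (hγ : κ.IsTopGenerator γ) (hγ' : IsCyclotomicVariable p γ) {Lplus Lminus : IwasawaAlgebra p}
    (hPP : IsPollackPair f p Lplus Lminus) (D : SignedSelmerDualData W κ γ ε) :
    W.selmerCorank p ≤ lam (kobayashiL ε Lplus Lminus) ∧
      Even (lam (kobayashiL ε Lplus Lminus) - W.selmerCorank p) := by
  have hle := selmerCorank_le_lam_kobayashiL h12 h41 hp hgood hap hf hκ hγ hγ' hPP D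
  exact ⟨hle, even_lam_sub_selmerCorank W p hpar hp hgood hap hf hPP ε hle⟩

/-- **The corank squeeze WIDENED BY ONE (per sign, image-free, `μ`-free): `λ(L_p^ε) ≤ corank + 1` suffices.** Granted
`h12`, `h41`, `hpar`; odd good `p`, `a_p = 0`. If `λ(L_p^ε) ≤ corank_{ℤ_p} Sel_{p^∞}(E/ℚ) + 1` for the Pollack pair at hand,
then — ONE excess zero being impossible by parity (`selmerCorank_add_two_le_lam_of_lt`) — `λ(L_p^ε) ≤ corank`, and g0's
squeeze `lambdaShape_of_lam_le_selmerCorank` gives the stub's `p`-inverted λ-shape at every dual datum of sign `ε`.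
[cite: Kobayashi2003, Thm. 1.2, Thm. 4.1 (p. 8) and Conjecture (p. 2)] [cite: DokchitserDokchitserAnnals2010, Thm. 1.4]
[cite: GreenbergLNM1716, §3 Lemma 3.1] -/
theorem lambdaShape_of_lam_le_selmerCorank_add_one (h12 : Kobayashi2003.thm12_signedSelmerDual_finite_torsion)
    (h41 : Kobayashi2003.thm41_signedCharIdeal_divisibility) (hpar : p_parity W p) (hp : p ≠ 2)
    (hgood : W.HasGoodReductionAtPrime p) (hap : W.frobeniusTrace p = 0) (hκ : κ.IsCyclotomic)
    (hγ : κ.IsTopGenerator γ) (hγ' : IsCyclotomicVariable p γ) [NeZero (W.conductorNorm ℤ)]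
    {f : CuspForm (Gamma0 (W.conductorNorm ℤ)) 2} (hf : IsNewformOf W f) {ϖ : ℚ}
    (hϖ : (ϖ : ℝ) * W.realPeriodRat = plusPeriod f) {Lplus Lminus : IwasawaAlgebra p}
    (hPP : IsPollackPair f p Lplus Lminus) (hle : lam (kobayashiL ε Lplus Lminus) ≤ W.selmerCorank p + 1)
    (D : SignedSelmerDualData W κ γ ε) :
    ∃ (g h : IwasawaAlgebra p) (m : ℕ), D.charIdeal = Ideal.span {g} ∧
      iwasawaToPowerSeries p (PowerSeries.C ((p : ℤ_[p]) ^ m) * g) =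
        PowerSeries.C (ϖ : ℚ_[p]) * iwasawaToPowerSeries p (kobayashiL ε Lplus Lminus * h) := by
  have hle' : lam (kobayashiL ε Lplus Lminus) ≤ W.selmerCorank p := by
    by_contra hlt
    have h2 := selmerCorank_add_two_le_lam_of_lt W p hpar hp hgood hap hf hPP ε (not_le.mp hlt)
    omega
  exact lambdaShape_of_lam_le_selmerCorank h12 h41 hp hgood hap hκ hγ hγ' hf hϖ hPP hle' D

end PerPair

/-! ## §2. Assembly: the stub BY NAME ⟸ loci ∧ `h12 h41` ∧ `p`-parity at `3` ∧ the PAIRED-EXCESS residue -/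

section Assembly

/-- **The stub BY NAME from the two preprint binders, Kobayashi Thm. 1.2 / 4.1, the `p`-parity theorem at `3`, and its
PAIRED-EXCESS RESIDUE.** Hypotheses BY NAME: `hFW`, `hBSTW` (the tree's two unrefereed binders, image-free), `h12`, `h41`
(published; only the rational display of Thm. 4.1), `hpar` (the `p`-parity theorem at `p = 3` for every `E/ℚ`:
Dokchitser–Dokchitser 2010 Thm. 1.4 with Cor. 4.20), and `hres2` — at every `p = 3`, X7, ¬CM, `a_3 = 0`, ¬Surj pair OFF
the Fouquet–Wan locus and OFF the BSTW twist locus, every cyclotomic frame, the newform, every Pollack pair whose `L_3^ε`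
has AT LEAST TWO EXCESS ZEROS (`corank_{ℤ_3} Sel_{3^∞}(E/ℚ) + 2 ≤ λ(L_3^ε)`), every dual datum and generator: the
Eisenstein λ-inequality `λ(L_3^ε) ≤ λ(ξ^ε)`. Proof: w3 g0's `smallImageLambdaLowerAtThree_of_loci_of_excessZeroResidue`
with its residue «`corank < λ`» fed by `hres2` through `selmerCorank_add_two_le_lam_of_lt` (excess zeros come in pairs).
READING: the sign with ONE would-be excess zero never occurs; no period fact and no `μ`-statement enters. CALIBRATION
ONLY: `hres2` is the stub's open content. [claim: FouquetWan2021, status: under-review]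
[claim: BurungaleSkinnerTianWan2024, status: under-review] [cite: Kobayashi2003, Thm. 1.2, Thm. 4.1 (p. 8), Conjecture (p. 2)]
[cite: DokchitserDokchitserAnnals2010, Thm. 1.4 and Cor. 4.20] [cite: Sprung2017, Cor. 4.14 (a_p = 0 display)] -/
theorem smallImageLambdaLowerAtThree_of_loci_of_pairedExcessZeroResidue
    (hFW : FouquetWan2021_thm51_via_kobayashi74_OPEN)
    (hBSTW : BurungaleSkinnerTianWan2024_thm13_twist_OPEN)
    (h12 : Kobayashi2003.thm12_signedSelmerDual_finite_torsion)
    (h41 : Kobayashi2003.thm41_signedCharIdeal_divisibility)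
    (hpar : ∀ (W : WeierstrassCurve ℚ) [W.IsElliptic], p_parity W 3)
    (hres2 : ∀ (W : WeierstrassCurve ℚ) [W.IsElliptic] [W.IsGloballyMinimal] (p : ℕ) [Fact p.Prime],
      p = 3 → ClassX7 W p → ¬ W.HasCM → W.frobeniusTrace p = 0 → ¬ Surj W p →
      (¬ ∃ (ℓ : ℕ) (_ : Fact ℓ.Prime), ℓ ≠ p ∧ W.HasMultiplicativeReductionAtPrime ℓ ∧
          ¬ W.HasSplitMultiplicativeReductionAtPrime ℓ ∧ ¬ p ∣ padicValInt ℓ W.minimalDiscriminantInt) →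
      (¬ ∃ (W₀ : WeierstrassCurve ℚ) (_ : W₀.IsElliptic) (_ : W₀.IsGloballyMinimal)
          (K : Type) (_ : Field K) (_ : NumberField K),
          Semistable W₀ ∧ GoodSS W₀ p ∧ (p = 3 → W₀.frobeniusTrace 3 = 0) ∧ Module.finrank ℚ K = 2 ∧
          IsCoprime (NumberField.discr K) ((W₀.conductorNorm ℤ * p : ℕ) : ℤ) ∧
          (∀ (ℓ : ℕ) [Fact ℓ.Prime], (ℓ : ℤ) ∣ NumberField.discr K → GoodOrd W₀ ℓ) ∧
          ∃ C : VariableChange ℚ, C • W₀.quadraticTwist (NumberField.discr K : ℚ) = W) →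
      ∀ (ε : ℤˣ) (κ : ZpExtension ℚ p) (γ : absoluteGaloisGroup ℚ),
          κ.IsCyclotomic → κ.IsTopGenerator γ → IsCyclotomicVariable p γ →
        ∀ [NeZero (W.conductorNorm ℤ)] (f : CuspForm (Gamma0 (W.conductorNorm ℤ)) 2), IsNewformOf W f →
        ∀ (Lplus Lminus : IwasawaAlgebra p), IsPollackPair f p Lplus Lminus →
          W.selmerCorank p + 2 ≤ lam (kobayashiL ε Lplus Lminus) →
        ∀ (D : SignedSelmerDualData W κ γ ε) (ξ : IwasawaAlgebra p), D.charIdeal = Ideal.span {ξ} →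
          lam (kobayashiL ε Lplus Lminus) ≤ lam ξ) :
    Summit.BirchSwinnertonDyer.BirchSwinnertonDyer.Theses.SignedLowerHalves.SmallImageLambdaLowerAtThree := by
  refine smallImageLambdaLowerAtThree_of_loci_of_excessZeroResidue hFW hBSTW h12 h41 ?_
  intro W _ _ p _ hp3 hX hCM hap hs hloc htw ε κ γ hκ hγ hγ' _ f hf Lplus Lminus hPP hlt D ξ hξ
  have hparW : p_parity W p := by subst hp3; exact hpar W
  have hp : p ≠ 2 := by rw [hp3]; decide
  exact hres2 W p hp3 hX hCM hap hs hloc htw ε κ γ hκ hγ hγ' f hf Lplus Lminus hPP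
    (selmerCorank_add_two_le_lam_of_lt W p hparW hp hX.1.1 hap hf hPP ε hlt) D ξ hξ

/-- **The converse (trivial): the stub implies its paired-excess residue** (indeed the λ-inequality everywhere, g0 §1),
granted `h12 h41` and the `p = 3` period comparison `h3` (which only supplies a period ratio to instantiate the stub).
[cite: Kobayashi2003, Thm. 1.2, Thm. 4.1 (p. 8) and Conjecture (p. 2)] [cite: Mazur1978, Cor. 4.1] -/
theorem pairedExcessZeroResidue_of_smallImageLambdaLowerAtThree
    (h12 : Kobayashi2003.thm12_signedSelmerDual_finite_torsion)
    (h41 : Kobayashi2003.thm41_signedCharIdeal_divisibility)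
    (h3 : realPeriodRat_eq_unit_mul_plusPeriod_three)
    (h : Summit.BirchSwinnertonDyer.BirchSwinnertonDyer.Theses.SignedLowerHalves.SmallImageLambdaLowerAtThree) :
    ∀ (W : WeierstrassCurve ℚ) [W.IsElliptic] [W.IsGloballyMinimal] (p : ℕ) [Fact p.Prime],
      p = 3 → ClassX7 W p → ¬ W.HasCM → W.frobeniusTrace p = 0 → ¬ Surj W p →
      (¬ ∃ (ℓ : ℕ) (_ : Fact ℓ.Prime), ℓ ≠ p ∧ W.HasMultiplicativeReductionAtPrime ℓ ∧
          ¬ W.HasSplitMultiplicativeReductionAtPrime ℓ ∧ ¬ p ∣ padicValInt ℓ W.minimalDiscriminantInt) →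
      (¬ ∃ (W₀ : WeierstrassCurve ℚ) (_ : W₀.IsElliptic) (_ : W₀.IsGloballyMinimal)
          (K : Type) (_ : Field K) (_ : NumberField K),
          Semistable W₀ ∧ GoodSS W₀ p ∧ (p = 3 → W₀.frobeniusTrace 3 = 0) ∧ Module.finrank ℚ K = 2 ∧
          IsCoprime (NumberField.discr K) ((W₀.conductorNorm ℤ * p : ℕ) : ℤ) ∧
          (∀ (ℓ : ℕ) [Fact ℓ.Prime], (ℓ : ℤ) ∣ NumberField.discr K → GoodOrd W₀ ℓ) ∧
          ∃ C : VariableChange ℚ, C • W₀.quadraticTwist (NumberField.discr K : ℚ) = W) →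
      ∀ (ε : ℤˣ) (κ : ZpExtension ℚ p) (γ : absoluteGaloisGroup ℚ),
          κ.IsCyclotomic → κ.IsTopGenerator γ → IsCyclotomicVariable p γ →
        ∀ [NeZero (W.conductorNorm ℤ)] (f : CuspForm (Gamma0 (W.conductorNorm ℤ)) 2), IsNewformOf W f →
        ∀ (Lplus Lminus : IwasawaAlgebra p), IsPollackPair f p Lplus Lminus →
          W.selmerCorank p + 2 ≤ lam (kobayashiL ε Lplus Lminus) →
        ∀ (D : SignedSelmerDualData W κ γ ε) (ξ : IwasawaAlgebra p), D.charIdeal = Ideal.span {ξ} →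
          lam (kobayashiL ε Lplus Lminus) ≤ lam ξ :=
  fun W _ _ p _ hp3 hX hCM hap hs hloc htw ε κ γ hκ hγ hγ' _ f hf Lplus Lminus hPP h2 D ξ hξ ↦
    excessZeroResidue_of_smallImageLambdaLowerAtThree h12 h41 h3 h W p hp3 hX hCM hap hs hloc htw ε κ γ hκ hγ hγ' f hf
      Lplus Lminus hPP (by omega) D ξ hξ

/-- **The residues of g0 and of this file are EQUIVALENT hypotheses** (granted `h12 h41` to place the corank below `λ`, and
`p`-parity at `3`): «λ-inequality at the pairs with `corank < λ(L_3^ε)`» ⟺ «λ-inequality at the pairs with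
`corank + 2 ≤ λ(L_3^ε)`» — stated for one pair, sign, frame, newform and Pollack pair as the implication that matters
(the other direction is weakening). [cite: DokchitserDokchitserAnnals2010, Thm. 1.4] [cite: Sprung2017, Cor. 4.14 (a_p = 0 display)] -/
theorem excess_iff_pairedExcess {p : ℕ} [Fact p.Prime] {W : WeierstrassCurve ℚ} [W.IsElliptic] [W.IsGloballyMinimal]
    (hpar : p_parity W p) (hp : p ≠ 2) (hgood : W.HasGoodReductionAtPrime p) (hap : W.frobeniusTrace p = 0)
    [NeZero (W.conductorNorm ℤ)] {f : CuspForm (Gamma0 (W.conductorNorm ℤ)) 2} (hf : IsNewformOf W f)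
    {Lplus Lminus : IwasawaAlgebra p} (hPP : IsPollackPair f p Lplus Lminus) (ε : ℤˣ) :
    W.selmerCorank p < lam (kobayashiL ε Lplus Lminus) ↔ W.selmerCorank p + 2 ≤ lam (kobayashiL ε Lplus Lminus) :=
  ⟨selmerCorank_add_two_le_lam_of_lt W p hpar hp hgood hap hf hPP ε, fun h ↦ by omega⟩

end Assembly

end Summit.BirchSwinnertonDyer.BirchSwinnertonDyer.Theorems.SmallImageLambdaLowerThreeNsParity

end
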